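import Summits.AtomisticToContinuum.Crystallization.Theses.PalmUnimodularRigidity
import Summits.AtomisticToContinuum.Crystallization.Theorems.MinimiserShells.Negative.LoadBearing
import Summits.AtomisticToContinuum.Crystallization.Theorems.MinimiserShells.Negative.Rootedness
import Summits.AtomisticToContinuum.Crystallization.Theorems.PalmUnimodularRigidityMinimiserShellsEquilibriumInLawAssembly
import Summits.AtomisticToContinuum.Crystallization.Theorems.LayeredLawsSelectHcp.Negative.FccModel
import Summits.AtomisticToContinuum.Crystallization.Theorems.PalmUnimodularRigidityMinimiserShellsEventTransferCell
import Literature.Probability.Process.PointStationaryLaw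
import Literature.MathematicalPhysics.StatisticalMechanics.RootEnergy
import Literature.MathematicalPhysics.StatisticalMechanics.MuGSC

/-!
# Event transfer: deep finite pricing of a local event kills it under minimising point-stationary laws

Helper file for stub `stub_pricingTransfer` (S8) of line `equilibrium-in-law-surgery` (lead reshape r3),
crux `MinimiserShells` (stmt-AtomisticToContinuum-9225).

**Theorem (`measure_event_eq_zero_of_deepPricing`).**  Let `δ > 0` and let `P` be a point-stationary
probability law on rooted `δ`-hard-core configurations of `ℝ³` which is minimising (`E_P[h] ≤ e*`) and
almost surely carried by configurations `count|S` with `K S` (any class `K`).  Let `E` be a measurable set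
of configurations ("the event, read at the root") and suppose the DEEP PRICING inequality with constants
`R₀, c > 0`: for every `δ`-separated `S` with `K S`, every finite `C ⊆ S` and every `G ⊆ C` consisting of
sites `y` at which the event holds after re-rooting (`count|(S − y) ∈ E`) and which are `R₀`-deep in `C`
(`S ∩ B̄(y, R₀) ⊆ C`), one has `#C · e* + c · #G ≤ ½ ∑∑_{C} V_LJ`.  Then `P E = 0`.

Proof: the cluster-periodisation machine of `…EquilibriumInLaw{CellAverage,CellSums,Assembly}` (random
grid of mesh `L` with ONE uniform phase, Mecke cell-average identity, depth penalties `tailBound`), run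
with the indicator of `E` in place of the gain event: `P(E) · c L³ ≤ (6 CT + 6 c R₀) L²` for every `L`.
This is the law-level transfer that consumes a FINITE, LINEAR pricing of deep sites and needs neither
volume growth nor surface tension: the energy and the event are averaged with the same weights.
-/

noncomputable section

open MeasureTheory ProbabilityTheory
open scoped ENNReal BigOperators Classical

namespace Summit.AtomisticToContinuum.Crystallization.Theorems.PalmUnimodularRigidityMinimiserShells.EventTransfer

open Literature.Probability.Process (IsPointStationaryLaw IsRootedHardCore count_restrict_singleton_ne_zero_iff
  map_sub_count_restrict)
open Literature.MathematicalPhysics.StatisticalMechanics (lennardJones IsMuGSC UniformlyDiscrete)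
open Summit.AtomisticToContinuum.Crystallization.Theses.PalmUnimodularRigidity (MinimiserShells UnimodularEnergyLowerBound)
open Summit.AtomisticToContinuum.Crystallization.Theorems.MinimiserShells.Negative.LoadBearing
  (eStar meanRootEnergy GoodShell minimiserShells_iff)
open Summit.AtomisticToContinuum.Crystallization.Theorems.MinimiserShells.Negative.Rootedness (E3
  countable_of_separated)
open Summit.AtomisticToContinuum.Crystallization.Theorems.LayeredLawsSelectHcp.Negative.FccModel
  (set_eq_of_count_restrict_eq)
open Summit.AtomisticToContinuum.Crystallization.Theorems.PalmUnimodularRigidityMinimiserShells.EquilibriumInLaw.LfKernel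
  (lfKernel lfKernel_count_restrict)
open Summit.AtomisticToContinuum.Crystallization.Theorems.PalmUnimodularRigidityMinimiserShells.EquilibriumInLaw.Phase
  (cube cell depth measurableSet_cube measurableSet_cell zero_mem_cell finite_inter_cell measurable_depth depth_nonneg)
open Summit.AtomisticToContinuum.Crystallization.Theorems.PalmUnimodularRigidityMinimiserShells.EquilibriumInLaw.Lattice
  (latticeL depth_add_of_mem_latticeL volume_cube)
open Summit.AtomisticToContinuum.Crystallization.Theorems.PalmUnimodularRigidityMinimiserShells.EquilibriumInLaw.RootSums
  (Bδ Bδ_nonneg tailBound tailBound_nonneg CT CT_nonneg)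
open Summit.AtomisticToContinuum.Crystallization.Theorems.PalmUnimodularRigidityMinimiserShells.EquilibriumInLaw.Cluster
  (tsum_sdiff_coe_eq_sum_add_tsum)
open Summit.AtomisticToContinuum.Crystallization.Theorems.PalmUnimodularRigidityMinimiserShells.EquilibriumInLaw.CellAverage
  (reroot reroot_eq_map measurable_reroot cellAvg measurable_cellAvg measurable_cellAvgIntegrand lintegral_cellAvg_eq)
open Summit.AtomisticToContinuum.Crystallization.Theorems.PalmUnimodularRigidityMinimiserShells.EquilibriumInLaw.CellSums
  (hTilde Bshift eStar_add_Bshift_nonneg F₁ F₂ measurable_F₁ measurable_F₂ F₁_periodic F₂_periodic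
  lintegral_cell_indicator count_restrict_cell cellAvg_count_restrict reroot_count_restrict F₁_reroot abs_tsum_le_Bδ)
open Summit.AtomisticToContinuum.Crystallization.Theorems.PalmUnimodularRigidityMinimiserShells.EquilibriumInLaw.WindowReal
  (inter_closedBall_subset_cell neg_tailBound_le_tsum)
open Summit.AtomisticToContinuum.Crystallization.Theorems.PalmUnimodularRigidityMinimiserShells.EquilibriumInLaw.Assembly
  (setLIntegral_F₂_le volume_cube_le_deep_add lintegral_cellAvg_F₁ lintegral_cellAvg_F₂ lintegral_ofReal_hTilde_le)

open Summit.AtomisticToContinuum.Crystallization.Theorems.PalmUnimodularRigidityMinimiserShells.EventTransferCell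
  (measurable_Fev Fev_periodic lintegral_cellAvg_Fev pointwise_cell_inequality)

/-! ## Integration against the law and the conclusion -/

/-- **The key inequality**: for every grid size `L > 0`, `P(E) · ofReal(c L³) ≤ ofReal((6 CT + 6 c R₀) L²)`. -/
theorem measure_event_mul_le {δ : ℝ} (hδ : 0 < δ) {P : Measure (Measure E3)} [IsProbabilityMeasure P]
    (hcore : ∀ᵐ μ ∂P, IsRootedHardCore δ μ) (hstat : IsPointStationaryLaw P) (hE : meanRootEnergy P ≤ eStar)
    {K : Set E3 → Prop}
    (hK : ∀ᵐ μ ∂P, ∃ S : Set E3, μ = (Measure.count : Measure E3).restrict S ∧ K S)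
    {Ev : Set (Measure E3)} (hEv : MeasurableSet Ev) {R₀ c : ℝ} (hR₀ : 0 < R₀) (hc : 0 < c)
    (hprice : ∀ S : Set E3, (∀ x ∈ S, ∀ z ∈ S, x ≠ z → δ ≤ dist x z) → K S →
      ∀ C : Finset E3, (↑C : Set E3) ⊆ S → ∀ G : Finset E3, G ⊆ C →
        (∀ y ∈ G, (Measure.count : Measure E3).restrict ((fun z => z - y) '' S) ∈ Ev ∧
          S ∩ Metric.closedBall y R₀ ⊆ ↑C) →
        (C.card : ℝ) * eStar + c * G.card ≤ (∑ x ∈ C, ∑ z ∈ C, lennardJones (dist x z)) / 2)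
    {L : ℝ} (hL : 0 < L) :
    P Ev * ENNReal.ofReal (c * L ^ 3) ≤ ENNReal.ofReal ((6 * CT δ + 6 * c * R₀) * L ^ 2) := by
  set Vg := (volume.restrict (cube L)) {u : E3 | R₀ < depth L u} with hVg
  set A := ENNReal.ofReal (eStar + Bshift δ) * volume (cube L) with hA
  have hAtop : A ≠ ∞ := by
    rw [hA, volume_cube hL.le]; exact ENNReal.mul_ne_top ENNReal.ofReal_ne_top ENNReal.ofReal_ne_top
  -- the pointwise inequality holds almost surely
  have hpwae : ∀ᵐ μ ∂P, A + ENNReal.ofReal c * cellAvg L (fun (μ : Measure E3) (u : E3) => Ev.indicator (1 : Measure E3 → ℝ≥0∞) μ * {u : E3 | R₀ < depth L u}.indicator (1 : E3 → ℝ≥0∞) u) μ ≤ cellAvg L (F₁ δ) μ + cellAvg L (F₂ δ L) μ := by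
    filter_upwards [hcore, hK] with μ hμ hKμ
    obtain ⟨S, h0, hsep, rfl⟩ := hμ
    obtain ⟨T, hT, hKT⟩ := hKμ
    obtain rfl : S = T := set_eq_of_count_restrict_eq hT
    exact pointwise_cell_inequality hδ h0 hsep hEv hc (hprice S hsep hKT) hL
  -- integrate the pointwise inequality
  have hint : A + ENNReal.ofReal c * ∫⁻ μ, cellAvg L (fun (μ : Measure E3) (u : E3) => Ev.indicator (1 : Measure E3 → ℝ≥0∞) μ * {u : E3 | R₀ < depth L u}.indicator (1 : E3 → ℝ≥0∞) u) μ ∂P ≤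
      ∫⁻ μ, cellAvg L (F₁ δ) μ ∂P + ∫⁻ μ, cellAvg L (F₂ δ L) μ ∂P := by
    have h3 := measurable_cellAvg (L := L) (measurable_Fev L R₀ hEv)
    have h1 := measurable_cellAvg (L := L) (measurable_F₁ δ)
    calc A + ENNReal.ofReal c * ∫⁻ μ, cellAvg L (fun (μ : Measure E3) (u : E3) => Ev.indicator (1 : Measure E3 → ℝ≥0∞) μ * {u : E3 | R₀ < depth L u}.indicator (1 : E3 → ℝ≥0∞) u) μ ∂P
        = ∫⁻ μ, (A + ENNReal.ofReal c * cellAvg L (fun (μ : Measure E3) (u : E3) => Ev.indicator (1 : Measure E3 → ℝ≥0∞) μ * {u : E3 | R₀ < depth L u}.indicator (1 : E3 → ℝ≥0∞) u) μ) ∂P := by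
          rw [lintegral_add_left measurable_const, lintegral_const, measure_univ, mul_one,
            lintegral_const_mul _ h3]
      _ ≤ ∫⁻ μ, (cellAvg L (F₁ δ) μ + cellAvg L (F₂ δ L) μ) ∂P := lintegral_mono_ae hpwae
      _ = _ := lintegral_add_left h1 _
  -- evaluate the three expectations
  rw [lintegral_cellAvg_F₁ hL hδ hcore hstat, lintegral_cellAvg_F₂ hL hδ hcore hstat,
    lintegral_cellAvg_Fev hL hδ hcore hstat R₀ hEv] at hint
  have hB1 := lintegral_ofReal_hTilde_le hδ hcore hE
  have hB2 := setLIntegral_F₂_le (δ := δ) hL (0 : Measure E3)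
  have hB3 := volume_cube_le_deep_add hL hR₀.le
  -- `A + c P(E) Vg ≤ A + 6L² CT`
  have hkey : ENNReal.ofReal c * (P Ev * Vg) ≤ ENNReal.ofReal (6 * L ^ 2) * ENNReal.ofReal (CT δ) := by
    have h' : A + ENNReal.ofReal c * (P Ev * Vg) ≤ A + ENNReal.ofReal (6 * L ^ 2) * ENNReal.ofReal (CT δ) :=
      calc A + ENNReal.ofReal c * (P Ev * Vg) ≤ (∫⁻ μ, ENNReal.ofReal (hTilde μ + Bshift δ) ∂P) * volume (cube L) +
            ∫⁻ u in cube L, F₂ δ L (0 : Measure E3) u := hint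
        _ ≤ A + ENNReal.ofReal (6 * L ^ 2) * ENNReal.ofReal (CT δ) :=
            add_le_add (mul_le_mul' hB1 le_rfl) hB2
    exact (ENNReal.add_le_add_iff_left hAtop).1 h'
  -- use `vol(cube) ≤ Vg + 6 R₀ L²` and `P(E) ≤ 1`
  have hPE1 : P Ev ≤ 1 := prob_le_one
  calc P Ev * ENNReal.ofReal (c * L ^ 3) = ENNReal.ofReal c * (P Ev * volume (cube L)) := by
        rw [ENNReal.ofReal_mul hc.le, volume_cube hL.le]; ring
    _ ≤ ENNReal.ofReal c * (P Ev * (Vg + ENNReal.ofReal (6 * R₀ * L ^ 2))) := by gcongr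
    _ = ENNReal.ofReal c * (P Ev * Vg) + ENNReal.ofReal c * P Ev * ENNReal.ofReal (6 * R₀ * L ^ 2) := by ring
    _ ≤ ENNReal.ofReal (6 * L ^ 2) * ENNReal.ofReal (CT δ) + ENNReal.ofReal c * 1 * ENNReal.ofReal (6 * R₀ * L ^ 2) := by
        gcongr
    _ = ENNReal.ofReal ((6 * CT δ + 6 * c * R₀) * L ^ 2) := by
        rw [mul_one, ← ENNReal.ofReal_mul (by positivity), ← ENNReal.ofReal_mul hc.le,
          ← ENNReal.ofReal_add (by have := CT_nonneg δ; positivity) (by positivity)]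
        congr 1
        ring

/-- **Event transfer theorem.**  Under a minimising point-stationary law on rooted `δ`-hard-core
configurations that is a.s. carried by a class `K`, a measurable event whose deep sites are linearly
priced on finite sub-windows of `K`-configurations is `P`-null. -/
theorem measure_event_eq_zero_of_deepPricing {δ : ℝ} (hδ : 0 < δ) {P : Measure (Measure E3)}
    [IsProbabilityMeasure P]
    (hcore : ∀ᵐ μ ∂P, IsRootedHardCore δ μ) (hstat : IsPointStationaryLaw P) (hE : meanRootEnergy P ≤ eStar)
    {K : Set E3 → Prop}
    (hK : ∀ᵐ μ ∂P, ∃ S : Set E3, μ = (Measure.count : Measure E3).restrict S ∧ K S)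
    {Ev : Set (Measure E3)} (hEv : MeasurableSet Ev) {R₀ c : ℝ} (hR₀ : 0 < R₀) (hc : 0 < c)
    (hprice : ∀ S : Set E3, (∀ x ∈ S, ∀ z ∈ S, x ≠ z → δ ≤ dist x z) → K S →
      ∀ C : Finset E3, (↑C : Set E3) ⊆ S → ∀ G : Finset E3, G ⊆ C →
        (∀ y ∈ G, (Measure.count : Measure E3).restrict ((fun z => z - y) '' S) ∈ Ev ∧
          S ∩ Metric.closedBall y R₀ ⊆ ↑C) →
        (C.card : ℝ) * eStar + c * G.card ≤ (∑ x ∈ C, ∑ z ∈ C, lennardJones (dist x z)) / 2) :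
    P Ev = 0 := by
  by_contra hne
  set p : ℝ := (P Ev).toReal with hp
  have hPtop : P Ev ≠ ∞ := measure_ne_top P Ev
  have hp0 : 0 < p := ENNReal.toReal_pos hne hPtop
  set Kc : ℝ := (6 * CT δ + 6 * c * R₀) / c with hKc
  have hK0 : 0 ≤ Kc := by have := CT_nonneg δ; positivity
  set L : ℝ := 2 * Kc / p + 1 with hLdef
  have hL : 0 < L := by positivity
  have hmain := measure_event_mul_le hδ hcore hstat hE hK hEv hR₀ hc hprice hL
  -- `P(E) ≤ ofReal (Kc / L)`
  have hdiv : P Ev ≤ ENNReal.ofReal (Kc / L) := by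
    have hcL : 0 < c * L ^ 3 := by positivity
    have h1 : P Ev ≤ ENNReal.ofReal ((6 * CT δ + 6 * c * R₀) * L ^ 2) / ENNReal.ofReal (c * L ^ 3) := by
      rw [ENNReal.le_div_iff_mul_le (Or.inl ((ENNReal.ofReal_pos.2 hcL).ne')) (Or.inl ENNReal.ofReal_ne_top)]
      exact hmain
    rw [← ENNReal.ofReal_div_of_pos hcL] at h1
    have heq : (6 * CT δ + 6 * c * R₀) * L ^ 2 / (c * L ^ 3) = Kc / L := by
      rw [hKc]; field_simp
    rwa [heq] at h1
  -- but `Kc / L < p`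
  have hlt : Kc / L < p := by
    rw [div_lt_iff₀ hL, hLdef]
    have : Kc < p * (2 * Kc / p + 1) := by
      rw [mul_add, mul_div_cancel₀ _ hp0.ne', mul_one]
      linarith
    linarith
  have : P Ev < P Ev :=
    calc P Ev ≤ ENNReal.ofReal (Kc / L) := hdiv
      _ < ENNReal.ofReal p := (ENNReal.ofReal_lt_ofReal_iff hp0).2 hlt
      _ = P Ev := ENNReal.ofReal_toReal hPtop
  exact lt_irrefl _ this

/-- Registered stub marker (helper part 01 of `stub_pricingTransfer`, line `equilibrium-in-law-surgery`, reshape r3):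
the event-transfer theorem `measure_event_eq_zero_of_deepPricing`, closed form. -/
theorem stub_pricingTransfer_part01 :
    ∀ (δ : ℝ), 0 < δ → ∀ (P : Measure (Measure (EuclideanSpace ℝ (Fin 3)))), IsProbabilityMeasure P →
      (∀ᵐ μ ∂P, IsRootedHardCore δ μ) → IsPointStationaryLaw P → meanRootEnergy P ≤ eStar →
      ∀ (K : Set (EuclideanSpace ℝ (Fin 3)) → Prop),
      (∀ᵐ μ ∂P, ∃ S : Set (EuclideanSpace ℝ (Fin 3)),
        μ = (Measure.count : Measure (EuclideanSpace ℝ (Fin 3))).restrict S ∧ K S) →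
      ∀ (Ev : Set (Measure (EuclideanSpace ℝ (Fin 3)))), MeasurableSet Ev → ∀ (R₀ c : ℝ), 0 < R₀ → 0 < c →
      (∀ S : Set (EuclideanSpace ℝ (Fin 3)), (∀ x ∈ S, ∀ z ∈ S, x ≠ z → δ ≤ dist x z) → K S →
        ∀ C : Finset (EuclideanSpace ℝ (Fin 3)), (↑C : Set (EuclideanSpace ℝ (Fin 3))) ⊆ S →
        ∀ G : Finset (EuclideanSpace ℝ (Fin 3)), G ⊆ C →
          (∀ y ∈ G, (Measure.count : Measure (EuclideanSpace ℝ (Fin 3))).restrict ((fun z => z - y) '' S) ∈ Ev ∧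
            S ∩ Metric.closedBall y R₀ ⊆ ↑C) →
          (C.card : ℝ) * eStar + c * G.card ≤ (∑ x ∈ C, ∑ z ∈ C, lennardJones (dist x z)) / 2) →
      P Ev = 0 :=
  fun _ hδ _ _ hcore hstat hE _ hK _ hEv _ _ hR₀ hc hprice =>
    measure_event_eq_zero_of_deepPricing hδ hcore hstat hE hK hEv hR₀ hc hprice

end Summit.AtomisticToContinuum.Crystallization.Theorems.PalmUnimodularRigidityMinimiserShells.EventTransfer

end
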